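import Summits.Langlands.Langlands.Theses.TwistControlLadder
import Summits.Langlands.Langlands.Theorems.RootDecomp1RestrictionTwistTransport
import Summits.Langlands.Langlands.Theorems.RootDecomp1InductionTransport

/-!
# `TwistControlLadder.WeakStepTransport` — proof of the support item stmt-Langlands-27464

**Weak-step transport** (WST, support · rank 9 of `route-Langlands-TwistControlLadder`, binder `hWS`
of its deciding theorem `closes`): semisimple a.e. Satake avatars are transported
(1) UP a restriction-plus-twist along an arbitrary finite extension `M/K₀`
    (`ρ₀ ↦ (ρ₀|_{Γ_M} ⊗ η_χ)^{ss}`), and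
(2) DOWN an a.e. automorphic induction `σ ↦ π = AI_{L/K}(σ)` (`r ↦ (Ind_{Γ_L}^{Γ_K} r)^{ss}`).

By its text the item is the literal conjunction of the two tree items
`RootDecomp1.RestrictionTwistTransport` (stmt-Langlands-29150; shared verbatim with
`CyclicDeinductionCarving.RestrictionTwistTransport`) and `RootDecomp1.InductionTransport`
(stmt-Langlands-29151), both PROVED OUTRIGHT in the tree
(`Summit.Langlands.Langlands.Theorems.restrictionTwistTransport_proof`,
`Summit.Langlands.Langlands.Theorems.inductionTransport_proof`; every input a theorem of the tree,
no Literature named fact).  This file records the conjunction, closing the item by name.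

References: Arthur–Clozel, *Simple algebras, base change, and the advanced theory of the trace
formula*, Ann. of Math. Stud. 120 (1989), Ch. 3 §§4–6; Deligne–Serre, ASENS 7 (1974), 6.12.
-/

set_option linter.dupNamespace false

namespace Summit.Langlands.Langlands.Theorems

/-- **`TwistControlLadder.WeakStepTransport` holds** (stmt-Langlands-27464): the conjunction of the
proved restriction–twist transport (stmt-Langlands-29150) and the proved induction transport
(stmt-Langlands-29151) of semisimple Satake avatars. [cite: ArthurClozel1989, Ch. 3 §§4–6] -/
theorem weakStepTransport_proof :
    Summit.Langlands.Langlands.Theses.TwistControlLadder.WeakStepTransport :=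
  ⟨restrictionTwistTransport_proof, inductionTransport_proof⟩

end Summit.Langlands.Langlands.Theorems
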